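/-
Copyright (c) 2026. All rights reserved.
Released under Apache 2.0 license as described in the file LICENSE.
b2b-lace LEAN TYPING SEAT 1 (lean1-g37), census row 11 (K/U/KM2 atoms at d := 10), column K_{n,0}: what-if /
input-certification lane; record certificate untouched.
-/
import Literature.Probability.FitznerVanDerHofstad2017.SrwKZeroAxisCellsD10
import Literature.Probability.FitznerVanDerHofstad2017.SrwKZeroFarRowsD10
import Literature.Probability.FitznerVanDerHofstad2017.SrwRegionSplitAxisCells
import Literature.Probability.FitznerVanDerHofstad2017.SrwKSupTableD10
import HarnessLib

/-!
# `K_{n,0}` region sups at `d = 10` from the axis cells, the m-uniform far rows and the CS cone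

Input-certification module at the SRW-table parameter `d := 10` (what-if lane).  For the diagrammatic-bound
quantity `K_{n,0}(x) = ∫ |D̂^{(x)}(k)| Ĉ(k)ⁿ dk/(2π)^d` ((3.36) p. 1071) this file proves literal sups over the
three standard regions of the bound assembly ((5.15)–(5.16) p. 1092, §5.1 p. 1093),

  `x ≠ 0 → K_{n,0}(x) ≤ S¹_n`,  `Σ_μ |x_μ| ≥ 2 → K_{n,0}(x) ≤ S²_n`,  `Σ_μ |x_μ| ≥ 3 → K_{n,0}(x) ≤ S³_n`,

each as ONE closed term over theorems already in the tree (no new analysis, no certificate, no definition):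
the region lemmas `srwK_le_of_axisFamily_nodeSplits_one/two/three` (`SrwRegionSplitAxisCells` §3: the sup over
a region is attained on the axis family `{±m e_i}` or controlled by Cauchy–Schwarz node splits
`K_{n,0}(y)² ≤ I_{n,0}(0) · W_{n,0}(y)` at the cone nodes `1^r` (`r ≥ 2`, resp. `r ≥ 3` together with `2e₁+e₂`,
`2e₁+2e₂`)), fed with

* the axis cells `K_{n,0}(m e_i) ≤ c_{n,m}`, `m = 1, …, 5` (`SrwKZeroAxisCellsD10.srwK_zero_cell_d10_n<n>_m<m>`,
  trigonometric-majorant device), peeled one by one (`axisFamily_of_cell_le_of_succ`);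
* the tail `|m| ≥ 6`: for `n ≤ 3` the m-uniform far row `SrwKZeroFarRowsD10.FarRowD10.srwK_zero_far_d10_n<n>`
  (`axisFamily_of_uniform_le`); for `n = 4` the Cauchy–Schwarz tail from `|m| ≥ 3` on,
  `srwK_axisFamily_of_seedBounds_cast` with `W_{4,0}(3e₁) ≤ KTUD10.wTab 4 0 .e3`;
* the cone: `KSupD10.i0_valid` (`I_{n,0}(0)`), `KSupD10.wOnes_valid` (`W_{n,0}(1^r)`), `KTUD10.wTab_valid .e12`
  (`W_{n,0}(2e₁+e₂)`, same `W_d`-orbit as `e₁+2e₂`), `KSupD10.pdTab_valid` (`W_{n,0}(2e₁+2e₂)`), closed by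
  `exists_split_of_seedBounds_cast` / `exists_pairSplit_of_seedBounds_cast` and `decide +kernel` on the rational
  comparisons `i0 · w ≤ S²`.

THE NUMBERS.  `S` = the least value on the `10⁻⁶` grid above every constraint of the region (cells, tail, cone);
in brackets the binding constraint; `tree` = the region value currently in the tree (`KTUD10.kA n 0 .e1/.e2/.e3`,
the CS-based `SrwKSupTableD10` sups), rounded UP at `10⁻⁶`:

* `n = 1`:  `x ≠ 0`: 0.205724 [cell m=1] (tree 0.251176);  `Σ|x_μ| ≥ 2`: 0.194651 [cell m=2] (tree 0.237124);  `Σ|x_μ| ≥ 3`: 0.194495 [cell m=3] (tree 0.236927).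
* `n = 2`:  `x ≠ 0`: 0.264049 [cell m=1] (tree 0.322970);  `Σ|x_μ| ≥ 2`: 0.222654 [cell m=2] (tree 0.271337);  `Σ|x_μ| ≥ 3`: 0.221423 [far row |m|>=6] (tree 0.269685).
* `n = 3`:  `x ≠ 0`: 0.399164 [cell m=1] (tree 0.485834);  `Σ|x_μ| ≥ 2`: 0.286086 [far row |m|>=6] (tree 0.349261);  `Σ|x_μ| ≥ 3`: 0.286086 [far row |m|>=6] (tree 0.338954).
* `n = 4`:  `x ≠ 0`: 0.775000 [cell m=1] (tree 0.929159);  `Σ|x_μ| ≥ 2`: 0.577368 [cone 1^2] (tree 0.599770);  `Σ|x_μ| ≥ 3`: —.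

(`n = 4`, `Σ|x_μ| ≥ 3` is not restated: there the CS tail at `3e₁` binds and the tree value stands.)

Sources: Fitzner–van der Hofstad [cite: FitznerVanDerHofstad2016NoBLE, (3.36) p. 1071, (5.15)–(5.16) p. 1092,
§5.1 p. 1093]; Hara–Slade, *Mean-field critical behaviour for percolation in high dimensions*, Comm. Math. Phys. 128
(1990), Lemma 5.6 p. 367 and App. B pp. 383–385 [cite: HaraSlade1990] (sup of a lattice integral over a region by
finitely many lattice points plus a uniform tail).
-/

namespace Literature.Probability.FitznerVanDerHofstad2017

open _root_.MeasureTheory Finset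
open scoped BigOperators

namespace KZeroSupD10

open KTUD10 KSupD10

/-! ### §1  Node rewriting and the three cone / tail `W`-suppliers at `j = 0` -/

/-- [folklore] -/
private theorem kz_vecOfParts_three : vecOfParts 10 [3] = Nd.pt .e3 := by decide +kernel
/-- [folklore] -/
private theorem kz_vecOfParts_two_two : vecOfParts 10 [2, 2] = Pi.single 0 2 + Pi.single 1 2 := by decide +kernel

/-- Equal absolute profiles give equal level-set counts. [folklore] -/
private theorem kz_card_abs_eq_of_absProf_eq {z z' : Fin 10 → ℤ} (h : absProf z = absProf z') (v : ℤ) :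
    Fintype.card {μ // |z μ| = v} = Fintype.card {μ // |z' μ| = v} := by
  have key : ∀ w : Fin 10 → ℤ, Fintype.card {μ // |w μ| = v} = Multiset.card ((absProf w).filter (· = v)) := by
    intro w
    rw [Fintype.card_subtype, absProf, Multiset.filter_map, Multiset.card_map]
    rfl
  rw [key, key, h]

/-- `W_{n,j}(2e₁+e₂) = W_{n,j}(e₁+2e₂)` (same `W_d`-orbit). [cite: FitznerVanDerHofstad2016NoBLE, (5.16) p. 1092] -/
private theorem kz_srwW_vecOfParts_two_one (n j : ℕ) :
    srwW 10 n j (vecOfParts 10 [2, 1]) = srwW 10 n j (Nd.pt .e12) := by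
  have hp : absProf (vecOfParts 10 [2, 1]) = absProf (Nd.pt .e12) := by decide +kernel
  obtain ⟨τ, hτ⟩ := exists_spAct_eq_of_card_abs_eq _ _ (kz_card_abs_eq_of_absProf_eq hp)
  rw [← hτ, srwW_spAct]

/-- `W_{n,0}(2e₁+e₂) ≤ wTab n 0 .e12`. [cite: FitznerVanDerHofstad2016NoBLE, (5.16) p. 1092] -/
private theorem w21_le {n : ℕ} (hn1 : 1 ≤ n) (hn : n ≤ 4) :
    srwW 10 n 0 (vecOfParts 10 [2, 1]) ≤ ((wTab n 0 .e12 : ℚ) : ℝ) := by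
  rw [kz_srwW_vecOfParts_two_one]
  exact wTab_valid .e12 hn1 hn (Nat.zero_le _)

/-- `W_{n,0}(2e₁+2e₂) ≤ pdTab n 0`. [cite: FitznerVanDerHofstad2016NoBLE, (5.16) p. 1092] -/
private theorem w22_le {n : ℕ} (hn1 : 1 ≤ n) (hn : n ≤ 4) :
    srwW 10 n 0 (vecOfParts 10 [2, 2]) ≤ ((pdTab n 0 : ℚ) : ℝ) := by
  rw [kz_vecOfParts_two_two]
  exact pdTab_valid hn1 hn (by norm_num)

/-- `W_{n,0}(3e₁) ≤ wTab n 0 .e3`. [cite: FitznerVanDerHofstad2016NoBLE, (5.16) p. 1092] -/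
private theorem w3_le {n : ℕ} (hn1 : 1 ≤ n) (hn : n ≤ 4) :
    srwW 10 n 0 (vecOfParts 10 [3]) ≤ ((wTab n 0 .e3 : ℚ) : ℝ) := by
  rw [kz_vecOfParts_three]
  exact wTab_valid .e3 hn1 hn (Nat.zero_le _)

/-- `K_{n,0}` is `W_d`-invariant. [cite: FitznerVanDerHofstad2016NoBLE, (3.36) p. 1071] -/
private theorem kInv (n : ℕ) : SpInvariant (srwK 10 n 0) := fun τ x => srwK_spAct n 0 τ x

/-! ### §2  The region sups -/

/-- **`K_{1,0}(x; 10) ≤ 0.205724` for `x \ne 0`** (binding constraint: cell m=1; tree region value 0.251176). [cite: FitznerVanDerHofstad2016NoBLE, (3.36) p. 1071, (5.15)–(5.16) p. 1092, §5.1 p. 1093] -/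
theorem srwK_zero_le_of_ne_zero_d10_n1 (x : Fin 10 → ℤ) (hx : x ≠ 0) :
    srwK 10 1 0 x ≤ ((205724 / 1000000 : ℚ) : ℝ) := by
  have hax : ∀ m : ℤ, 1 ≤ m.natAbs → srwK 10 1 0 (Pi.single (0 : Fin 10) m) ≤ ((205724 / 1000000 : ℚ) : ℝ) :=
    axisFamily_of_cell_le_of_succ (kInv 1) 0 (m₀ := 1) (srwK_zero_cell_d10_n1_m1 0)
      (Rat.cast_le.mpr (by norm_num)) <|
    axisFamily_of_cell_le_of_succ (kInv 1) 0 (m₀ := 2) (srwK_zero_cell_d10_n1_m2 0)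
      (Rat.cast_le.mpr (by norm_num)) <|
    axisFamily_of_cell_le_of_succ (kInv 1) 0 (m₀ := 3) (srwK_zero_cell_d10_n1_m3 0)
      (Rat.cast_le.mpr (by norm_num)) <|
    axisFamily_of_cell_le_of_succ (kInv 1) 0 (m₀ := 4) (srwK_zero_cell_d10_n1_m4 0)
      (Rat.cast_le.mpr (by norm_num)) <|
    axisFamily_of_cell_le_of_succ (kInv 1) 0 (m₀ := 5) (srwK_zero_cell_d10_n1_m5 0)
      (Rat.cast_le.mpr (by norm_num)) <|
    axisFamily_of_uniform_le (F := srwK 10 1 0) 0 (M := 6)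
      (fun m hm => FarRowD10.srwK_zero_far_d10_n1 0 m hm) (Rat.cast_le.mpr (by norm_num))
  have hcone : ∀ r : ℕ, 2 ≤ r → r ≤ 10 → i0 1 0 * wOnes 1 0 r ≤ (205724 / 1000000 : ℚ) ^ 2 := by
    intro r h2 h10
    interval_cases r <;> decide +kernel
  have h := srwK_le_of_axisFamily_nodeSplits_one (d := 10) (n := 1) (by norm_num) (by norm_num) 0
    (((205724 / 1000000 : ℚ)) : ℝ) (((205724 / 1000000 : ℚ)) : ℝ) (0 : Fin 10) hax
    (fun r hr2 hr => exists_split_of_seedBounds_cast (d := 10) (n := 1) 0 0 (by norm_num) (classVec 10 r 0)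
      (i0_valid (by norm_num) (by norm_num)) (wOnes_valid (by norm_num) (by norm_num) (by norm_num) hr2 hr)
      (by norm_num) (hcone r hr2 hr)) x hx
  simpa only [max_self] using h

/-- **`K_{1,0}(x; 10) ≤ 0.194651` for `Σ|x_μ| ≥ 2`** (binding constraint: cell m=2; tree region value 0.237124). [cite: FitznerVanDerHofstad2016NoBLE, (3.36) p. 1071, (5.15)–(5.16) p. 1092, §5.1 p. 1093] -/
theorem srwK_zero_le_of_two_le_d10_n1 (x : Fin 10 → ℤ) (hx : 2 ≤ ∑ j, |x j|) :
    srwK 10 1 0 x ≤ ((194651 / 1000000 : ℚ) : ℝ) := by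
  have hax : ∀ m : ℤ, 2 ≤ m.natAbs → srwK 10 1 0 (Pi.single (0 : Fin 10) m) ≤ ((194651 / 1000000 : ℚ) : ℝ) :=
    axisFamily_of_cell_le_of_succ (kInv 1) 0 (m₀ := 2) (srwK_zero_cell_d10_n1_m2 0)
      (Rat.cast_le.mpr (by norm_num)) <|
    axisFamily_of_cell_le_of_succ (kInv 1) 0 (m₀ := 3) (srwK_zero_cell_d10_n1_m3 0)
      (Rat.cast_le.mpr (by norm_num)) <|
    axisFamily_of_cell_le_of_succ (kInv 1) 0 (m₀ := 4) (srwK_zero_cell_d10_n1_m4 0)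
      (Rat.cast_le.mpr (by norm_num)) <|
    axisFamily_of_cell_le_of_succ (kInv 1) 0 (m₀ := 5) (srwK_zero_cell_d10_n1_m5 0)
      (Rat.cast_le.mpr (by norm_num)) <|
    axisFamily_of_uniform_le (F := srwK 10 1 0) 0 (M := 6)
      (fun m hm => FarRowD10.srwK_zero_far_d10_n1 0 m hm) (Rat.cast_le.mpr (by norm_num))
  have hcone : ∀ r : ℕ, 2 ≤ r → r ≤ 10 → i0 1 0 * wOnes 1 0 r ≤ (194651 / 1000000 : ℚ) ^ 2 := by
    intro r h2 h10
    interval_cases r <;> decide +kernel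
  have h := srwK_le_of_axisFamily_nodeSplits_two (d := 10) (n := 1) (by norm_num) (by norm_num) 0
    (((194651 / 1000000 : ℚ)) : ℝ) (((194651 / 1000000 : ℚ)) : ℝ) (0 : Fin 10) hax
    (fun r hr2 hr => exists_split_of_seedBounds_cast (d := 10) (n := 1) 0 0 (by norm_num) (classVec 10 r 0)
      (i0_valid (by norm_num) (by norm_num)) (wOnes_valid (by norm_num) (by norm_num) (by norm_num) hr2 hr)
      (by norm_num) (hcone r hr2 hr)) x hx
  simpa only [max_self] using h

/-- **`K_{1,0}(x; 10) ≤ 0.194495` for `Σ|x_μ| ≥ 3`** (binding constraint: cell m=3; tree region value 0.236927). [cite: FitznerVanDerHofstad2016NoBLE, (3.36) p. 1071, (5.15)–(5.16) p. 1092, §5.1 p. 1093] -/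
theorem srwK_zero_le_of_three_le_d10_n1 (x : Fin 10 → ℤ) (hx : 3 ≤ ∑ j, |x j|) :
    srwK 10 1 0 x ≤ ((194495 / 1000000 : ℚ) : ℝ) := by
  have hax : ∀ m : ℤ, 3 ≤ m.natAbs → srwK 10 1 0 (Pi.single (0 : Fin 10) m) ≤ ((194495 / 1000000 : ℚ) : ℝ) :=
    axisFamily_of_cell_le_of_succ (kInv 1) 0 (m₀ := 3) (srwK_zero_cell_d10_n1_m3 0)
      (Rat.cast_le.mpr (by norm_num)) <|
    axisFamily_of_cell_le_of_succ (kInv 1) 0 (m₀ := 4) (srwK_zero_cell_d10_n1_m4 0)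
      (Rat.cast_le.mpr (by norm_num)) <|
    axisFamily_of_cell_le_of_succ (kInv 1) 0 (m₀ := 5) (srwK_zero_cell_d10_n1_m5 0)
      (Rat.cast_le.mpr (by norm_num)) <|
    axisFamily_of_uniform_le (F := srwK 10 1 0) 0 (M := 6)
      (fun m hm => FarRowD10.srwK_zero_far_d10_n1 0 m hm) (Rat.cast_le.mpr (by norm_num))
  have hcone : ∀ r : ℕ, 3 ≤ r → r ≤ 10 → i0 1 0 * wOnes 1 0 r ≤ (194495 / 1000000 : ℚ) ^ 2 := by
    intro r h2 h10
    interval_cases r <;> decide +kernel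
  have h := srwK_le_of_axisFamily_nodeSplits_three (d := 10) (n := 1) (by norm_num) (by norm_num) 0
    (((194495 / 1000000 : ℚ)) : ℝ) (((194495 / 1000000 : ℚ)) : ℝ) (0 : Fin 10) hax
    (exists_pairSplit_of_seedBounds_cast (d := 10) (n := 1) 0 0 (by norm_num)
      (i0_valid (by norm_num) (by norm_num)) (w21_le (by norm_num) (by norm_num)) (w22_le (by norm_num) (by norm_num))
      (by norm_num) (by decide +kernel) (by decide +kernel))
    (fun r hr2 hr => exists_split_of_seedBounds_cast (d := 10) (n := 1) 0 0 (by norm_num) (classVec 10 r 0)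
      (i0_valid (by norm_num) (by norm_num)) (wOnes_valid (by norm_num) (by norm_num) (by norm_num) ((show 2 ≤ 3 by norm_num).trans hr2) hr)
      (by norm_num) (hcone r hr2 hr)) x hx
  simpa only [max_self] using h

/-- **`K_{2,0}(x; 10) ≤ 0.264049` for `x \ne 0`** (binding constraint: cell m=1; tree region value 0.322970). [cite: FitznerVanDerHofstad2016NoBLE, (3.36) p. 1071, (5.15)–(5.16) p. 1092, §5.1 p. 1093] -/
theorem srwK_zero_le_of_ne_zero_d10_n2 (x : Fin 10 → ℤ) (hx : x ≠ 0) :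
    srwK 10 2 0 x ≤ ((264049 / 1000000 : ℚ) : ℝ) := by
  have hax : ∀ m : ℤ, 1 ≤ m.natAbs → srwK 10 2 0 (Pi.single (0 : Fin 10) m) ≤ ((264049 / 1000000 : ℚ) : ℝ) :=
    axisFamily_of_cell_le_of_succ (kInv 2) 0 (m₀ := 1) (srwK_zero_cell_d10_n2_m1 0)
      (Rat.cast_le.mpr (by norm_num)) <|
    axisFamily_of_cell_le_of_succ (kInv 2) 0 (m₀ := 2) (srwK_zero_cell_d10_n2_m2 0)
      (Rat.cast_le.mpr (by norm_num)) <|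
    axisFamily_of_cell_le_of_succ (kInv 2) 0 (m₀ := 3) (srwK_zero_cell_d10_n2_m3 0)
      (Rat.cast_le.mpr (by norm_num)) <|
    axisFamily_of_cell_le_of_succ (kInv 2) 0 (m₀ := 4) (srwK_zero_cell_d10_n2_m4 0)
      (Rat.cast_le.mpr (by norm_num)) <|
    axisFamily_of_cell_le_of_succ (kInv 2) 0 (m₀ := 5) (srwK_zero_cell_d10_n2_m5 0)
      (Rat.cast_le.mpr (by norm_num)) <|
    axisFamily_of_uniform_le (F := srwK 10 2 0) 0 (M := 6)
      (fun m hm => FarRowD10.srwK_zero_far_d10_n2 0 m hm) (Rat.cast_le.mpr (by norm_num))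
  have hcone : ∀ r : ℕ, 2 ≤ r → r ≤ 10 → i0 2 0 * wOnes 2 0 r ≤ (264049 / 1000000 : ℚ) ^ 2 := by
    intro r h2 h10
    interval_cases r <;> decide +kernel
  have h := srwK_le_of_axisFamily_nodeSplits_one (d := 10) (n := 2) (by norm_num) (by norm_num) 0
    (((264049 / 1000000 : ℚ)) : ℝ) (((264049 / 1000000 : ℚ)) : ℝ) (0 : Fin 10) hax
    (fun r hr2 hr => exists_split_of_seedBounds_cast (d := 10) (n := 2) 0 0 (by norm_num) (classVec 10 r 0)
      (i0_valid (by norm_num) (by norm_num)) (wOnes_valid (by norm_num) (by norm_num) (by norm_num) hr2 hr)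
      (by norm_num) (hcone r hr2 hr)) x hx
  simpa only [max_self] using h

/-- **`K_{2,0}(x; 10) ≤ 0.222654` for `Σ|x_μ| ≥ 2`** (binding constraint: cell m=2; tree region value 0.271337). [cite: FitznerVanDerHofstad2016NoBLE, (3.36) p. 1071, (5.15)–(5.16) p. 1092, §5.1 p. 1093] -/
theorem srwK_zero_le_of_two_le_d10_n2 (x : Fin 10 → ℤ) (hx : 2 ≤ ∑ j, |x j|) :
    srwK 10 2 0 x ≤ ((222654 / 1000000 : ℚ) : ℝ) := by
  have hax : ∀ m : ℤ, 2 ≤ m.natAbs → srwK 10 2 0 (Pi.single (0 : Fin 10) m) ≤ ((222654 / 1000000 : ℚ) : ℝ) :=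
    axisFamily_of_cell_le_of_succ (kInv 2) 0 (m₀ := 2) (srwK_zero_cell_d10_n2_m2 0)
      (Rat.cast_le.mpr (by norm_num)) <|
    axisFamily_of_cell_le_of_succ (kInv 2) 0 (m₀ := 3) (srwK_zero_cell_d10_n2_m3 0)
      (Rat.cast_le.mpr (by norm_num)) <|
    axisFamily_of_cell_le_of_succ (kInv 2) 0 (m₀ := 4) (srwK_zero_cell_d10_n2_m4 0)
      (Rat.cast_le.mpr (by norm_num)) <|
    axisFamily_of_cell_le_of_succ (kInv 2) 0 (m₀ := 5) (srwK_zero_cell_d10_n2_m5 0)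
      (Rat.cast_le.mpr (by norm_num)) <|
    axisFamily_of_uniform_le (F := srwK 10 2 0) 0 (M := 6)
      (fun m hm => FarRowD10.srwK_zero_far_d10_n2 0 m hm) (Rat.cast_le.mpr (by norm_num))
  have hcone : ∀ r : ℕ, 2 ≤ r → r ≤ 10 → i0 2 0 * wOnes 2 0 r ≤ (222654 / 1000000 : ℚ) ^ 2 := by
    intro r h2 h10
    interval_cases r <;> decide +kernel
  have h := srwK_le_of_axisFamily_nodeSplits_two (d := 10) (n := 2) (by norm_num) (by norm_num) 0
    (((222654 / 1000000 : ℚ)) : ℝ) (((222654 / 1000000 : ℚ)) : ℝ) (0 : Fin 10) hax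
    (fun r hr2 hr => exists_split_of_seedBounds_cast (d := 10) (n := 2) 0 0 (by norm_num) (classVec 10 r 0)
      (i0_valid (by norm_num) (by norm_num)) (wOnes_valid (by norm_num) (by norm_num) (by norm_num) hr2 hr)
      (by norm_num) (hcone r hr2 hr)) x hx
  simpa only [max_self] using h

/-- **`K_{2,0}(x; 10) ≤ 0.221423` for `Σ|x_μ| ≥ 3`** (binding constraint: far row |m|>=6; tree region value 0.269685). [cite: FitznerVanDerHofstad2016NoBLE, (3.36) p. 1071, (5.15)–(5.16) p. 1092, §5.1 p. 1093] -/
theorem srwK_zero_le_of_three_le_d10_n2 (x : Fin 10 → ℤ) (hx : 3 ≤ ∑ j, |x j|) :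
    srwK 10 2 0 x ≤ ((221423 / 1000000 : ℚ) : ℝ) := by
  have hax : ∀ m : ℤ, 3 ≤ m.natAbs → srwK 10 2 0 (Pi.single (0 : Fin 10) m) ≤ ((221423 / 1000000 : ℚ) : ℝ) :=
    axisFamily_of_cell_le_of_succ (kInv 2) 0 (m₀ := 3) (srwK_zero_cell_d10_n2_m3 0)
      (Rat.cast_le.mpr (by norm_num)) <|
    axisFamily_of_cell_le_of_succ (kInv 2) 0 (m₀ := 4) (srwK_zero_cell_d10_n2_m4 0)
      (Rat.cast_le.mpr (by norm_num)) <|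
    axisFamily_of_cell_le_of_succ (kInv 2) 0 (m₀ := 5) (srwK_zero_cell_d10_n2_m5 0)
      (Rat.cast_le.mpr (by norm_num)) <|
    axisFamily_of_uniform_le (F := srwK 10 2 0) 0 (M := 6)
      (fun m hm => FarRowD10.srwK_zero_far_d10_n2 0 m hm) (Rat.cast_le.mpr (by norm_num))
  have hcone : ∀ r : ℕ, 3 ≤ r → r ≤ 10 → i0 2 0 * wOnes 2 0 r ≤ (221423 / 1000000 : ℚ) ^ 2 := by
    intro r h2 h10
    interval_cases r <;> decide +kernel
  have h := srwK_le_of_axisFamily_nodeSplits_three (d := 10) (n := 2) (by norm_num) (by norm_num) 0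
    (((221423 / 1000000 : ℚ)) : ℝ) (((221423 / 1000000 : ℚ)) : ℝ) (0 : Fin 10) hax
    (exists_pairSplit_of_seedBounds_cast (d := 10) (n := 2) 0 0 (by norm_num)
      (i0_valid (by norm_num) (by norm_num)) (w21_le (by norm_num) (by norm_num)) (w22_le (by norm_num) (by norm_num))
      (by norm_num) (by decide +kernel) (by decide +kernel))
    (fun r hr2 hr => exists_split_of_seedBounds_cast (d := 10) (n := 2) 0 0 (by norm_num) (classVec 10 r 0)
      (i0_valid (by norm_num) (by norm_num)) (wOnes_valid (by norm_num) (by norm_num) (by norm_num) ((show 2 ≤ 3 by norm_num).trans hr2) hr)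
      (by norm_num) (hcone r hr2 hr)) x hx
  simpa only [max_self] using h

/-- **`K_{3,0}(x; 10) ≤ 0.399164` for `x \ne 0`** (binding constraint: cell m=1; tree region value 0.485834). [cite: FitznerVanDerHofstad2016NoBLE, (3.36) p. 1071, (5.15)–(5.16) p. 1092, §5.1 p. 1093] -/
theorem srwK_zero_le_of_ne_zero_d10_n3 (x : Fin 10 → ℤ) (hx : x ≠ 0) :
    srwK 10 3 0 x ≤ ((399164 / 1000000 : ℚ) : ℝ) := by
  have hax : ∀ m : ℤ, 1 ≤ m.natAbs → srwK 10 3 0 (Pi.single (0 : Fin 10) m) ≤ ((399164 / 1000000 : ℚ) : ℝ) :=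
    axisFamily_of_cell_le_of_succ (kInv 3) 0 (m₀ := 1) (srwK_zero_cell_d10_n3_m1 0)
      (Rat.cast_le.mpr (by norm_num)) <|
    axisFamily_of_cell_le_of_succ (kInv 3) 0 (m₀ := 2) (srwK_zero_cell_d10_n3_m2 0)
      (Rat.cast_le.mpr (by norm_num)) <|
    axisFamily_of_cell_le_of_succ (kInv 3) 0 (m₀ := 3) (srwK_zero_cell_d10_n3_m3 0)
      (Rat.cast_le.mpr (by norm_num)) <|
    axisFamily_of_cell_le_of_succ (kInv 3) 0 (m₀ := 4) (srwK_zero_cell_d10_n3_m4 0)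
      (Rat.cast_le.mpr (by norm_num)) <|
    axisFamily_of_cell_le_of_succ (kInv 3) 0 (m₀ := 5) (srwK_zero_cell_d10_n3_m5 0)
      (Rat.cast_le.mpr (by norm_num)) <|
    axisFamily_of_uniform_le (F := srwK 10 3 0) 0 (M := 6)
      (fun m hm => FarRowD10.srwK_zero_far_d10_n3 0 m hm) (Rat.cast_le.mpr (by norm_num))
  have hcone : ∀ r : ℕ, 2 ≤ r → r ≤ 10 → i0 3 0 * wOnes 3 0 r ≤ (399164 / 1000000 : ℚ) ^ 2 := by
    intro r h2 h10
    interval_cases r <;> decide +kernel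
  have h := srwK_le_of_axisFamily_nodeSplits_one (d := 10) (n := 3) (by norm_num) (by norm_num) 0
    (((399164 / 1000000 : ℚ)) : ℝ) (((399164 / 1000000 : ℚ)) : ℝ) (0 : Fin 10) hax
    (fun r hr2 hr => exists_split_of_seedBounds_cast (d := 10) (n := 3) 0 0 (by norm_num) (classVec 10 r 0)
      (i0_valid (by norm_num) (by norm_num)) (wOnes_valid (by norm_num) (by norm_num) (by norm_num) hr2 hr)
      (by norm_num) (hcone r hr2 hr)) x hx
  simpa only [max_self] using h

/-- **`K_{3,0}(x; 10) ≤ 0.286086` for `Σ|x_μ| ≥ 2`** (binding constraint: far row |m|>=6; tree region value 0.349261). [cite: FitznerVanDerHofstad2016NoBLE, (3.36) p. 1071, (5.15)–(5.16) p. 1092, §5.1 p. 1093] -/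
theorem srwK_zero_le_of_two_le_d10_n3 (x : Fin 10 → ℤ) (hx : 2 ≤ ∑ j, |x j|) :
    srwK 10 3 0 x ≤ ((286086 / 1000000 : ℚ) : ℝ) := by
  have hax : ∀ m : ℤ, 2 ≤ m.natAbs → srwK 10 3 0 (Pi.single (0 : Fin 10) m) ≤ ((286086 / 1000000 : ℚ) : ℝ) :=
    axisFamily_of_cell_le_of_succ (kInv 3) 0 (m₀ := 2) (srwK_zero_cell_d10_n3_m2 0)
      (Rat.cast_le.mpr (by norm_num)) <|
    axisFamily_of_cell_le_of_succ (kInv 3) 0 (m₀ := 3) (srwK_zero_cell_d10_n3_m3 0)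
      (Rat.cast_le.mpr (by norm_num)) <|
    axisFamily_of_cell_le_of_succ (kInv 3) 0 (m₀ := 4) (srwK_zero_cell_d10_n3_m4 0)
      (Rat.cast_le.mpr (by norm_num)) <|
    axisFamily_of_cell_le_of_succ (kInv 3) 0 (m₀ := 5) (srwK_zero_cell_d10_n3_m5 0)
      (Rat.cast_le.mpr (by norm_num)) <|
    axisFamily_of_uniform_le (F := srwK 10 3 0) 0 (M := 6)
      (fun m hm => FarRowD10.srwK_zero_far_d10_n3 0 m hm) (Rat.cast_le.mpr (by norm_num))
  have hcone : ∀ r : ℕ, 2 ≤ r → r ≤ 10 → i0 3 0 * wOnes 3 0 r ≤ (286086 / 1000000 : ℚ) ^ 2 := by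
    intro r h2 h10
    interval_cases r <;> decide +kernel
  have h := srwK_le_of_axisFamily_nodeSplits_two (d := 10) (n := 3) (by norm_num) (by norm_num) 0
    (((286086 / 1000000 : ℚ)) : ℝ) (((286086 / 1000000 : ℚ)) : ℝ) (0 : Fin 10) hax
    (fun r hr2 hr => exists_split_of_seedBounds_cast (d := 10) (n := 3) 0 0 (by norm_num) (classVec 10 r 0)
      (i0_valid (by norm_num) (by norm_num)) (wOnes_valid (by norm_num) (by norm_num) (by norm_num) hr2 hr)
      (by norm_num) (hcone r hr2 hr)) x hx
  simpa only [max_self] using h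

/-- **`K_{3,0}(x; 10) ≤ 0.286086` for `Σ|x_μ| ≥ 3`** (binding constraint: far row |m|>=6; tree region value 0.338954). [cite: FitznerVanDerHofstad2016NoBLE, (3.36) p. 1071, (5.15)–(5.16) p. 1092, §5.1 p. 1093] -/
theorem srwK_zero_le_of_three_le_d10_n3 (x : Fin 10 → ℤ) (hx : 3 ≤ ∑ j, |x j|) :
    srwK 10 3 0 x ≤ ((286086 / 1000000 : ℚ) : ℝ) := by
  have hax : ∀ m : ℤ, 3 ≤ m.natAbs → srwK 10 3 0 (Pi.single (0 : Fin 10) m) ≤ ((286086 / 1000000 : ℚ) : ℝ) :=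
    axisFamily_of_cell_le_of_succ (kInv 3) 0 (m₀ := 3) (srwK_zero_cell_d10_n3_m3 0)
      (Rat.cast_le.mpr (by norm_num)) <|
    axisFamily_of_cell_le_of_succ (kInv 3) 0 (m₀ := 4) (srwK_zero_cell_d10_n3_m4 0)
      (Rat.cast_le.mpr (by norm_num)) <|
    axisFamily_of_cell_le_of_succ (kInv 3) 0 (m₀ := 5) (srwK_zero_cell_d10_n3_m5 0)
      (Rat.cast_le.mpr (by norm_num)) <|
    axisFamily_of_uniform_le (F := srwK 10 3 0) 0 (M := 6)
      (fun m hm => FarRowD10.srwK_zero_far_d10_n3 0 m hm) (Rat.cast_le.mpr (by norm_num))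
  have hcone : ∀ r : ℕ, 3 ≤ r → r ≤ 10 → i0 3 0 * wOnes 3 0 r ≤ (286086 / 1000000 : ℚ) ^ 2 := by
    intro r h2 h10
    interval_cases r <;> decide +kernel
  have h := srwK_le_of_axisFamily_nodeSplits_three (d := 10) (n := 3) (by norm_num) (by norm_num) 0
    (((286086 / 1000000 : ℚ)) : ℝ) (((286086 / 1000000 : ℚ)) : ℝ) (0 : Fin 10) hax
    (exists_pairSplit_of_seedBounds_cast (d := 10) (n := 3) 0 0 (by norm_num)
      (i0_valid (by norm_num) (by norm_num)) (w21_le (by norm_num) (by norm_num)) (w22_le (by norm_num) (by norm_num))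
      (by norm_num) (by decide +kernel) (by decide +kernel))
    (fun r hr2 hr => exists_split_of_seedBounds_cast (d := 10) (n := 3) 0 0 (by norm_num) (classVec 10 r 0)
      (i0_valid (by norm_num) (by norm_num)) (wOnes_valid (by norm_num) (by norm_num) (by norm_num) ((show 2 ≤ 3 by norm_num).trans hr2) hr)
      (by norm_num) (hcone r hr2 hr)) x hx
  simpa only [max_self] using h

/-- **`K_{4,0}(x; 10) ≤ 0.775000` for `x \ne 0`** (binding constraint: cell m=1; tree region value 0.929159). [cite: FitznerVanDerHofstad2016NoBLE, (3.36) p. 1071, (5.15)–(5.16) p. 1092, §5.1 p. 1093] -/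
theorem srwK_zero_le_of_ne_zero_d10_n4 (x : Fin 10 → ℤ) (hx : x ≠ 0) :
    srwK 10 4 0 x ≤ ((775000 / 1000000 : ℚ) : ℝ) := by
  have hax : ∀ m : ℤ, 1 ≤ m.natAbs → srwK 10 4 0 (Pi.single (0 : Fin 10) m) ≤ ((775000 / 1000000 : ℚ) : ℝ) :=
    axisFamily_of_cell_le_of_succ (kInv 4) 0 (m₀ := 1) (srwK_zero_cell_d10_n4_m1 0)
      (Rat.cast_le.mpr (by norm_num)) <|
    axisFamily_of_cell_le_of_succ (kInv 4) 0 (m₀ := 2) (srwK_zero_cell_d10_n4_m2 0)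
      (Rat.cast_le.mpr (by norm_num)) <|
    srwK_axisFamily_of_seedBounds_cast (d := 10) (n := 4) (by norm_num) (by norm_num) (0 : Fin 10) 3 0 0
      (by norm_num) (i0_valid (by norm_num) (by norm_num)) (w3_le (by norm_num) (by norm_num)) (by norm_num)
      (by decide +kernel)
  have hcone : ∀ r : ℕ, 2 ≤ r → r ≤ 10 → i0 4 0 * wOnes 4 0 r ≤ (775000 / 1000000 : ℚ) ^ 2 := by
    intro r h2 h10
    interval_cases r <;> decide +kernel
  have h := srwK_le_of_axisFamily_nodeSplits_one (d := 10) (n := 4) (by norm_num) (by norm_num) 0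
    (((775000 / 1000000 : ℚ)) : ℝ) (((775000 / 1000000 : ℚ)) : ℝ) (0 : Fin 10) hax
    (fun r hr2 hr => exists_split_of_seedBounds_cast (d := 10) (n := 4) 0 0 (by norm_num) (classVec 10 r 0)
      (i0_valid (by norm_num) (by norm_num)) (wOnes_valid (by norm_num) (by norm_num) (by norm_num) hr2 hr)
      (by norm_num) (hcone r hr2 hr)) x hx
  simpa only [max_self] using h

/-- **`K_{4,0}(x; 10) ≤ 0.577368` for `Σ|x_μ| ≥ 2`** (binding constraint: cone 1^2; tree region value 0.599770). [cite: FitznerVanDerHofstad2016NoBLE, (3.36) p. 1071, (5.15)–(5.16) p. 1092, §5.1 p. 1093] -/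
theorem srwK_zero_le_of_two_le_d10_n4 (x : Fin 10 → ℤ) (hx : 2 ≤ ∑ j, |x j|) :
    srwK 10 4 0 x ≤ ((577368 / 1000000 : ℚ) : ℝ) := by
  have hax : ∀ m : ℤ, 2 ≤ m.natAbs → srwK 10 4 0 (Pi.single (0 : Fin 10) m) ≤ ((577368 / 1000000 : ℚ) : ℝ) :=
    axisFamily_of_cell_le_of_succ (kInv 4) 0 (m₀ := 2) (srwK_zero_cell_d10_n4_m2 0)
      (Rat.cast_le.mpr (by norm_num)) <|
    srwK_axisFamily_of_seedBounds_cast (d := 10) (n := 4) (by norm_num) (by norm_num) (0 : Fin 10) 3 0 0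
      (by norm_num) (i0_valid (by norm_num) (by norm_num)) (w3_le (by norm_num) (by norm_num)) (by norm_num)
      (by decide +kernel)
  have hcone : ∀ r : ℕ, 2 ≤ r → r ≤ 10 → i0 4 0 * wOnes 4 0 r ≤ (577368 / 1000000 : ℚ) ^ 2 := by
    intro r h2 h10
    interval_cases r <;> decide +kernel
  have h := srwK_le_of_axisFamily_nodeSplits_two (d := 10) (n := 4) (by norm_num) (by norm_num) 0
    (((577368 / 1000000 : ℚ)) : ℝ) (((577368 / 1000000 : ℚ)) : ℝ) (0 : Fin 10) hax
    (fun r hr2 hr => exists_split_of_seedBounds_cast (d := 10) (n := 4) 0 0 (by norm_num) (classVec 10 r 0)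
      (i0_valid (by norm_num) (by norm_num)) (wOnes_valid (by norm_num) (by norm_num) (by norm_num) hr2 hr)
      (by norm_num) (hcone r hr2 hr)) x hx
  simpa only [max_self] using h

end KZeroSupD10

end Literature.Probability.FitznerVanDerHofstad2017
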